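import Summits.AtomisticToContinuum.HydrodynamicLimit.Theorems.TwoClocksClampedTransferWindowLDStubStationaryTruncation
import HarnessLib

/-!
# `TransferActivityTails` (stmt-AtomisticToContinuum-16624), line `Sketch` (idea `predictor-drift-doob`):
stub `stub_blockSum`

Window concatenation on the good set of the hard-sphere flow: for a good datum `z`, a start `s`, a block
length `w ≥ 0`, any functional `F` of the collision record and any `K : ℕ`, the collision sum over the window
`(s, s + K w]` along the orbit of `z` is the sum over `j < K` of the collision sums over the consecutive blocks
`(s + j w, s + (j + 1) w]`.  Induction on `K`: the empty window `(s, s]` carries the zero sum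
(`collisionPairSum_empty`), and the step is the additivity of collision sums over adjacent half-open windows
on the good set (`ClampedTransferCoin.collisionSum_Ioc_add_Ioc`, finitely many collision times in bounded
windows).  No new definitions.
-/

noncomputable section

open MeasureTheory Set
open scoped BigOperators

namespace Summit.AtomisticToContinuum.HydrodynamicLimit.Theorems.TransferActivityTailsBlockSum

open Summit.AtomisticToContinuum.HydrodynamicLimit.Theorems.ClampedTransferCoin
  (Flow Phase Rec window impulse collisionSum_Ioc_add_Ioc)
open Literature.MathematicalPhysics.KineticTheory Literature.Analysis.FluidPDE

/-- **Window concatenation with an arbitrary start** (good set): for `w ≥ 0` and `K : ℕ`,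
`CS(s, s + K w] = Σ_{j<K} CS(s + j w, s + (j+1) w]` along the orbit of a good datum `z`, for every functional
`F` of the collision record.  Induction on `K` (`collisionPairSum_empty` for the empty window,
`collisionSum_Ioc_add_Ioc` for the step). [folklore] -/
theorem collisionSum_Ioc_eq_sum_blocks {σ : ℝ} {N : ℕ} (Φ : Flow σ N) {z : Phase N} (hz : z ∈ Φ.good)
    (s : ℝ) {w : ℝ} (hw : 0 ≤ w) (F : Rec N → ℝ) (K : ℕ) :
    Φ.collisionSum (Set.Ioc s (s + K * w)) F z =
      ∑ j ∈ Finset.range K, Φ.collisionSum (Set.Ioc (s + j * w) (s + (j + 1) * w)) F z := by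
  induction K with
  | zero =>
    rw [Finset.sum_range_zero, Nat.cast_zero, zero_mul, add_zero, Ioc_self, HardSphereFlow.collisionSum_eq,
      collisionSum_eq_collisionPairSum, collisionPairSum_empty]
  | succ K ih =>
    have h1 : s ≤ s + (K : ℝ) * w := le_add_of_nonneg_right (mul_nonneg K.cast_nonneg hw)
    have h2 : s + (K : ℝ) * w ≤ s + ((K : ℝ) + 1) * w := by nlinarith
    rw [Finset.sum_range_succ, ← ih, Nat.cast_succ, collisionSum_Ioc_add_Ioc Φ hz h1 h2 F]

/-- **STUB (window concatenation)** — registered signature of line `Sketch`, crux `TransferActivityTails`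
(stmt-AtomisticToContinuum-16624): on the good set, `CS(s, s + K w] = Σ_{j<K} CS(s + j w, s + (j+1) w]`
(route-internal window algebra, `collisionSum_Ioc_eq_sum_blocks`). [folklore] -/
theorem stub_blockSum :
    ∀ (σ : ℝ) (N : ℕ) (Φ : Flow σ N) (z : Phase N), z ∈ Φ.good → ∀ (s w : ℝ), 0 ≤ w → ∀ (F : Rec N → ℝ) (K : ℕ),
    Φ.collisionSum (Set.Ioc s (s + K * w)) F z =
      ∑ j ∈ Finset.range K, Φ.collisionSum (Set.Ioc (s + j * w) (s + (j + 1) * w)) F z :=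
  fun _σ _N Φ _z hz s _w hw F K => collisionSum_Ioc_eq_sum_blocks Φ hz s hw F K

end Summit.AtomisticToContinuum.HydrodynamicLimit.Theorems.TransferActivityTailsBlockSum

end
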